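import Summits.Parity.GeneralizedHardyLittlewood.Theorems.GreenTaoLevelTwoMNTwoFejerSmoothing

/-!
# Route `GreenTaoLevelTwo`, crux `MNTwo` (stmt-Parity-21276), line `birth`, stub `stub_mnVertical`:
# Möbius is orthogonal to `1`-step nilsequences on tori, linearly in the Lipschitz constant
# (GT 2008b §6 (mu-1-step), every dimension)

Block V1 of the `stub_mnVertical` census (B. Green, T. Tao, *Quadratic uniformity of the Möbius
function*, Ann. Inst. Fourier 58 (2008) = arXiv:math/0606087, §6, eq. (mu-1-step): "`μ` is orthogonal
to `1`-step nilsequences … By Lemma (lip-extend) and Lemma (fourier-approx) … it suffices to establish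
(mu-alpha)"): for `F : ℝᵏ → ℂ` `ℤᵏ`-periodic, `1`-bounded and `M`-Lipschitz for the sup metric, a
rotation `α ∈ ℝᵏ`, a point `x` and a twist `β`,
`‖∑_{n ≤ N} μ(n) F(x + nα) e(nβ)‖ ≤ C_{k,A} · M · N / log^A N`.
Proof by induction on `k`, smoothing one coordinate at a time with the Fejér kernel
(`…MNTwoFejerSmoothing`): the smoothing in the first coordinate is an exponential polynomial in that
coordinate whose `(H+1)²` coefficients are `(H+1)⁻¹`-small `M(H+1)⁻¹`-Lipschitz periodic functions of
the other coordinates (induction hypothesis at exponent `3A`), with error `Mδ + 1/((H+1)δ)`;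
`δ = log^{−A} N`, `H + 1 ≍ log^{2A} N`.  Base case `k = 0`: Davenport.  Def-free:

* `cons_add_one_eq`, `cons_add_single_eq`, `dist_cons_cons_le_abs`, `dist_cons_cons_le_dist` —
  bookkeeping for `Fin.cons`;
* `norm_sum_moebius_lipschitz_torus_le` — the estimate above.

References: [GreenTao2008QuadraticMobius] arXiv:math/0606087 §6 (mu-1-step), App. Lemma
(fourier-approx); H. Davenport, Quart. J. Math. 8 (1937) 313–320.
-/

noncomputable section

open Finset Real MeasureTheory intervalIntegral ArithmeticFunction
open scoped FourierTransform ArithmeticFunction.Moebius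

namespace Summit.Parity.GeneralizedHardyLittlewood.GreenTaoLevelTwoMNTwoMoebiusLipschitzTorus

open Literature.NumberTheory.Sieve.Vinogradov (afExpSum norm_fourierChar)
open Literature.NumberTheory.Sieve.MoebiusDavenport (davenport)
open Literature.NumberTheory.Sieve.FejerCounting (fejerKernel fejerKernel_nonneg continuous_fejerKernel
  continuous_fourierChar_mul)
open Summit.Parity.GeneralizedHardyLittlewood.GreenTaoLevelTwoMNTwoFejerSmoothing

/-! ### §1 Bookkeeping for `Fin.cons` -/

/-- `cons (s+1) z = cons s z + e₀`. [folklore] -/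
theorem cons_add_one_eq {k : ℕ} (s : ℝ) (z : Fin k → ℝ) :
    (Fin.cons (s + 1) z : Fin (k + 1) → ℝ) = Fin.cons s z + Pi.single 0 1 := by
  ext i
  refine Fin.cases ?_ (fun j => ?_) i
  · simp
  · simp [Fin.cons_succ, Fin.succ_ne_zero]

/-- `cons s (z + e_j) = cons s z + e_{j+1}`. [folklore] -/
theorem cons_add_single_eq {k : ℕ} (s : ℝ) (z : Fin k → ℝ) (j : Fin k) :
    (Fin.cons s (z + Pi.single j 1) : Fin (k + 1) → ℝ) = Fin.cons s z + Pi.single j.succ 1 := by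
  ext i
  refine Fin.cases ?_ (fun j' => ?_) i
  · simp [Fin.succ_ne_zero]
  · simp only [Fin.cons_succ, Pi.add_apply, Pi.single_apply, Fin.succ_inj]

/-- `dist (cons s z) (cons s' z) ≤ |s − s'|` (sup metric). [folklore] -/
theorem dist_cons_cons_le_abs {k : ℕ} (s s' : ℝ) (z : Fin k → ℝ) :
    dist (Fin.cons s z : Fin (k + 1) → ℝ) (Fin.cons s' z) ≤ |s - s'| := by
  refine (dist_pi_le_iff (abs_nonneg _)).2 fun i => ?_
  refine Fin.cases ?_ (fun j => ?_) i
  · simp [Real.dist_eq]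
  · simp

/-- `dist (cons s z) (cons s w) ≤ dist z w` (sup metric). [folklore] -/
theorem dist_cons_cons_le_dist {k : ℕ} (s : ℝ) (z w : Fin k → ℝ) :
    dist (Fin.cons s z : Fin (k + 1) → ℝ) (Fin.cons s w) ≤ dist z w := by
  refine (dist_pi_le_iff dist_nonneg).2 fun i => ?_
  refine Fin.cases ?_ (fun j => ?_) i
  · simp
  · simp only [Fin.cons_succ]; exact dist_le_pi_dist z w j

/-! ### §2 The estimate -/

/-- **Möbius is orthogonal to `1`-step nilsequences on the `k`-torus, linearly in the Lipschitz
constant (GT 2008b (mu-1-step)).**  For every `k` and `A > 0` there is `C` such that for all `M ≥ 1`,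
all `ℤᵏ`-periodic `F : ℝᵏ → ℂ` with `‖F‖ ≤ 1` and `‖F x − F y‖ ≤ M · dist x y` (sup metric), all
`N ≥ 2`, all `α, x ∈ ℝᵏ` and `β ∈ ℝ`:
`‖∑_{n ≤ N} μ(n) F(x + nα) e(nβ)‖ ≤ C · M · N / log^A N`.
[cite: GreenTao2008QuadraticMobius, §6, (mu-1-step)] -/
theorem norm_sum_moebius_lipschitz_torus_le (k : ℕ) :
    ∀ {A : ℝ}, 0 < A → ∃ C : ℝ, ∀ M : ℝ, 1 ≤ M → ∀ F : (Fin k → ℝ) → ℂ,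
      (∀ x (i : Fin k), F (x + Pi.single i 1) = F x) → (∀ x, ‖F x‖ ≤ 1) →
      (∀ x y, ‖F x - F y‖ ≤ M * dist x y) → ∀ N : ℕ, 2 ≤ N → ∀ (α x : Fin k → ℝ) (β : ℝ),
        ‖∑ n ∈ Icc 1 N, ((μ n : ℝ) : ℂ) * (F (x + (n : ℝ) • α) * (𝐞 ((n : ℝ) * β) : ℂ))‖ ≤
          C * M * N / Real.log N ^ A := by
  induction k with
  | zero =>
    intro A hA
    obtain ⟨C, hC⟩ := davenport A hA
    refine ⟨max C 0, fun M hM F _ hF1 _ N hN α x β => ?_⟩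
    have hNpos : (0 : ℝ) < N := by exact_mod_cast (show 0 < N by omega)
    have hlog : 0 < Real.log N := Real.log_pos (by exact_mod_cast (show 1 < N by omega))
    have hLA : 0 < Real.log N ^ A := Real.rpow_pos_of_pos hlog A
    have hconst : ∀ n : ℕ, F (x + (n : ℝ) • α) = F 0 := fun n => by rw [Subsingleton.elim (x + (n : ℝ) • α) 0]
    simp_rw [hconst]
    have e : ∑ n ∈ Icc 1 N, ((μ n : ℝ) : ℂ) * (F 0 * (𝐞 ((n : ℝ) * β) : ℂ)) =
        F 0 * afExpSum (fun n => (μ n : ℝ)) N β := by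
      unfold afExpSum; rw [Finset.mul_sum]
      exact Finset.sum_congr rfl fun n _ => by ring
    rw [e, norm_mul]
    calc ‖F 0‖ * ‖afExpSum (fun n => (μ n : ℝ)) N β‖ ≤ 1 * (C * N / Real.log N ^ A) :=
          mul_le_mul (hF1 0) (hC N hN β) (norm_nonneg _) zero_le_one
      _ ≤ max C 0 * M * N / Real.log N ^ A := by
          rw [one_mul, div_le_div_iff_of_pos_right hLA]
          have h1 : C * N ≤ max C 0 * N := mul_le_mul_of_nonneg_right (le_max_left _ _) hNpos.le
          have h2 : max C 0 * N ≤ max C 0 * M * N := by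
            have : max C 0 * N * 1 ≤ max C 0 * N * M :=
              mul_le_mul_of_nonneg_left hM (mul_nonneg (le_max_right _ _) hNpos.le)
            linarith
          linarith
  | succ k ih =>
    intro A hA
    obtain ⟨C', hC'⟩ := ih (A := 3 * A) (by linarith)
    -- `C'` may be taken nonnegative
    have hC'0 : ∀ M : ℝ, 1 ≤ M → ∀ G : (Fin k → ℝ) → ℂ,
        (∀ x (i : Fin k), G (x + Pi.single i 1) = G x) → (∀ x, ‖G x‖ ≤ 1) →
        (∀ x y, ‖G x - G y‖ ≤ M * dist x y) → ∀ N : ℕ, 2 ≤ N → ∀ (α x : Fin k → ℝ) (β : ℝ),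
        ‖∑ n ∈ Icc 1 N, ((μ n : ℝ) : ℂ) * (G (x + (n : ℝ) • α) * (𝐞 ((n : ℝ) * β) : ℂ))‖ ≤
          max C' 0 * M * N / Real.log N ^ (3 * A) := by
      intro M hM G hGp hG1 hGl N hN α x β
      refine (hC' M hM G hGp hG1 hGl N hN α x β).trans ?_
      have hlog : 0 < Real.log N := Real.log_pos (by exact_mod_cast (show 1 < N by omega))
      rw [div_le_div_iff_of_pos_right (Real.rpow_pos_of_pos hlog _)]
      have : 0 ≤ M * N := mul_nonneg (by linarith) (Nat.cast_nonneg _)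
      nlinarith [le_max_left C' 0]
    refine ⟨3 * max C' 0 + 4, fun M hM F hFp hF1 hFl N hN α x β => ?_⟩
    have hM0 : 0 ≤ M := by linarith
    have hNpos : (0 : ℝ) < N := by exact_mod_cast (show 0 < N by omega)
    have hlog : 0 < Real.log N := Real.log_pos (by exact_mod_cast (show 1 < N by omega))
    have hLA : 0 < Real.log N ^ A := Real.rpow_pos_of_pos hlog A
    have hC0 : 0 ≤ max C' 0 := le_max_right _ _
    -- trivial bound
    have htriv : ‖∑ n ∈ Icc 1 N, ((μ n : ℝ) : ℂ) * (F (x + (n : ℝ) • α) * (𝐞 ((n : ℝ) * β) : ℂ))‖ ≤ N := by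
      calc _ ≤ ∑ n ∈ Icc 1 N, ‖((μ n : ℝ) : ℂ) * (F (x + (n : ℝ) • α) * (𝐞 ((n : ℝ) * β) : ℂ))‖ :=
            norm_sum_le _ _
        _ ≤ ∑ _n ∈ Icc 1 N, (1 : ℝ) := Finset.sum_le_sum fun n _ => by
            rw [norm_mul, norm_mul, norm_fourierChar, mul_one, Complex.norm_real, Real.norm_eq_abs]
            calc |(μ n : ℝ)| * ‖F (x + (n : ℝ) • α)‖ ≤ 1 * 1 := by
                  refine mul_le_mul ?_ (hF1 _) (norm_nonneg _) zero_le_one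
                  exact_mod_cast ArithmeticFunction.abs_moebius_le_one
              _ = 1 := one_mul 1
        _ = N := by simp
    by_cases hsmall : Real.log N ≤ 1
    · have h1 : Real.log N ^ A ≤ 1 := Real.rpow_le_one hlog.le hsmall hA.le
      refine htriv.trans ?_
      rw [le_div_iff₀ hLA]
      have h3 : (N : ℝ) * Real.log N ^ A ≤ N * 1 := mul_le_mul_of_nonneg_left h1 hNpos.le
      have h4 : (N : ℝ) ≤ (3 * max C' 0 + 4) * M * N := by
        have : (1 : ℝ) ≤ (3 * max C' 0 + 4) * M := by nlinarith
        nlinarith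
      linarith
    push Not at hsmall
    -- parameters
    set L : ℝ := Real.log N with hL
    have hL1 : 1 < L := hsmall
    have hLA1 : 1 ≤ L ^ A := Real.one_le_rpow hL1.le hA.le
    obtain ⟨δ, hδ⟩ : ∃ δ : ℝ, δ = min (1 / 2) (1 / L ^ A) := ⟨_, rfl⟩
    have hδ0 : 0 < δ := by rw [hδ]; exact lt_min (by norm_num) (by positivity)
    have hδ2 : δ ≤ 1 / 2 := by rw [hδ]; exact min_le_left _ _
    have hδA : δ ≤ 1 / L ^ A := by rw [hδ]; exact min_le_right _ _
    have hδlo : 1 / (2 * L ^ A) ≤ δ := by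
      rw [hδ]
      refine le_min ?_ ?_
      · rw [div_le_div_iff₀ (by positivity) (by norm_num)]; nlinarith
      · exact div_le_div_of_nonneg_left zero_le_one (by positivity) (by nlinarith)
    obtain ⟨H, hH⟩ : ∃ H : ℕ, H = ⌈L ^ (2 * A)⌉₊ := ⟨_, rfl⟩
    have hHlo : L ^ (2 * A) ≤ (H : ℝ) + 1 := by
      rw [hH]; exact (Nat.le_ceil _).trans (by linarith)
    have hHhi : (H : ℝ) + 1 ≤ L ^ (2 * A) + 2 := by
      rw [hH]
      have := Nat.ceil_lt_add_one (Real.rpow_nonneg hlog.le (2 * A))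
      linarith
    have hL2A : L ^ (2 * A) = L ^ A * L ^ A := by
      rw [show 2 * A = A + A by ring, Real.rpow_add hlog]
    have hL3A : L ^ (3 * A) = L ^ A * L ^ A * L ^ A := by
      rw [show 3 * A = A + A + A by ring, Real.rpow_add hlog, Real.rpow_add hlog]
    have hHpos : (0 : ℝ) < H + 1 := by positivity
    -- the sections `s ↦ F(cons s z)`
    have hsec_per : ∀ z : Fin k → ℝ, Function.Periodic (fun s => F (Fin.cons s z)) 1 := by
      intro z s; simp only; rw [cons_add_one_eq, hFp]
    have hsec_lip : ∀ (z : Fin k → ℝ) (s s' : ℝ), ‖F (Fin.cons s z) - F (Fin.cons s' z)‖ ≤ M * |s - s'| :=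
      fun z s s' => (hFl _ _).trans (mul_le_mul_of_nonneg_left (dist_cons_cons_le_abs s s' z) hM0)
    have hsec_cont : ∀ z : Fin k → ℝ, Continuous (fun s => F (Fin.cons s z)) := by
      intro z
      refine continuous_iff_continuousAt.2 fun s₀ => ?_
      refine Metric.continuousAt_iff.2 fun ε hε => ⟨ε / M, div_pos hε (by linarith), fun s hs => ?_⟩
      rw [dist_eq_norm]
      calc ‖F (Fin.cons s z) - F (Fin.cons s₀ z)‖ ≤ M * |s - s₀| := hsec_lip z s s₀
        _ < M * (ε / M) := mul_lt_mul_of_pos_left (by rwa [Real.dist_eq] at hs) (by linarith)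
        _ = ε := by field_simp
    -- the coefficient functions (scaled by `H + 1`)
    set c : ℕ → ℕ → (Fin k → ℝ) → ℂ := fun p p' z =>
      ∫ s in (0 : ℝ)..1, F (Fin.cons s z) * (𝐞 (((p' : ℝ) - p) * s) : ℂ) with hc
    have hc1 : ∀ p p' z, ‖c p p' z‖ ≤ 1 := by
      intro p p' z
      have := intervalIntegral.norm_integral_le_of_norm_le_const (a := (0 : ℝ)) (b := 1) (C := 1)
        (f := fun s => F (Fin.cons s z) * (𝐞 (((p' : ℝ) - p) * s) : ℂ)) (fun s _ => by
          rw [norm_mul, norm_fourierChar, mul_one]; exact hF1 _)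
      simpa [hc] using this
    have hcper : ∀ p p' z (j : Fin k), c p p' (z + Pi.single j 1) = c p p' z := by
      intro p p' z j
      simp only [hc]
      refine intervalIntegral.integral_congr fun s _ => ?_
      show F (Fin.cons s (z + Pi.single j 1)) * _ = F (Fin.cons s z) * _
      rw [cons_add_single_eq, hFp]
    have hclip : ∀ p p' z w, ‖c p p' z - c p p' w‖ ≤ M * dist z w := by
      intro p p' z w
      simp only [hc]
      have hi : ∀ u : Fin k → ℝ, IntervalIntegrable
          (fun s => F (Fin.cons s u) * (𝐞 (((p' : ℝ) - p) * s) : ℂ)) volume 0 1 := fun u =>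
        ((hsec_cont u).mul (continuous_fourierChar_mul _)).intervalIntegrable _ _
      rw [← intervalIntegral.integral_sub (hi z) (hi w)]
      have := intervalIntegral.norm_integral_le_of_norm_le_const (a := (0 : ℝ)) (b := 1)
        (C := M * dist z w)
        (f := fun s => F (Fin.cons s z) * (𝐞 (((p' : ℝ) - p) * s) : ℂ) -
          F (Fin.cons s w) * (𝐞 (((p' : ℝ) - p) * s) : ℂ)) (fun s _ => by
          rw [← sub_mul, norm_mul, norm_fourierChar, mul_one]
          exact (hFl _ _).trans (mul_le_mul_of_nonneg_left (dist_cons_cons_le_dist s z w) hM0))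
      simpa using this
    -- the smoothing in the first coordinate along the orbit
    have horb_tail : ∀ n : ℕ, Fin.tail (x + (n : ℝ) • α) = Fin.tail x + (n : ℝ) • Fin.tail α :=
      fun n => by ext j; simp [Fin.tail]
    have horb_zero : ∀ n : ℕ, (x + (n : ℝ) • α) 0 = x 0 + (n : ℝ) * α 0 := fun n => by simp
    set g : ℕ → ℂ := fun n => ∫ t in (0 : ℝ)..1,
      F (Fin.cons ((x + (n : ℝ) • α) 0 - t) (Fin.tail (x + (n : ℝ) • α))) * (fejerKernel H t : ℂ) with hg
    have herr : ∀ n : ℕ, ‖g n - F (x + (n : ℝ) • α)‖ ≤ 3 * M / L ^ A := by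
      intro n
      have h0 := norm_fejer_smoothing_sub_le (hsec_cont (Fin.tail (x + (n : ℝ) • α)))
        (hsec_per _) (fun s => hF1 _) hM0 (fun s s' => hsec_lip _ s s') H hδ0 hδ2 ((x + (n : ℝ) • α) 0)
      rw [Fin.cons_self_tail] at h0
      refine h0.trans ?_
      have h1 : M * δ ≤ M / L ^ A := by
        calc M * δ ≤ M * (1 / L ^ A) := mul_le_mul_of_nonneg_left hδA hM0
          _ = M / L ^ A := by ring
      have h2 : 1 / ((H + 1) * δ) ≤ 2 / L ^ A := by
        rw [div_le_div_iff₀ (by positivity) (by positivity)]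
        have h3 : L ^ A * L ^ A * (1 / (2 * L ^ A)) ≤ (H + 1) * δ := by
          calc L ^ A * L ^ A * (1 / (2 * L ^ A)) = L ^ (2 * A) * (1 / (2 * L ^ A)) := by rw [hL2A]
            _ ≤ (H + 1) * δ := mul_le_mul hHlo hδlo (by positivity) (by positivity)
        have e : L ^ A * L ^ A * (1 / (2 * L ^ A)) = L ^ A / 2 := by field_simp
        rw [e] at h3
        linarith
      have h3 : M / L ^ A + 2 / L ^ A ≤ 3 * M / L ^ A := by
        rw [← add_div, div_le_div_iff_of_pos_right (by positivity)]; linarith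
      linarith
    have hexp : ∀ n : ℕ, g n * (𝐞 ((n : ℝ) * β) : ℂ) =
        ∑ q ∈ Ioc 0 (H + 1) ×ˢ Ioc 0 (H + 1), (𝐞 (((q.1 : ℝ) - q.2) * x 0) : ℂ) * ((H : ℂ) + 1)⁻¹ *
          (c q.1 q.2 (Fin.tail x + (n : ℝ) • Fin.tail α) *
            (𝐞 ((n : ℝ) * (β + ((q.1 : ℝ) - q.2) * α 0)) : ℂ)) := by
      intro n
      rw [hg]; simp only
      rw [fejer_smoothing_eq_sum (hsec_cont _) (hsec_per _) H, horb_tail, horb_zero, Finset.sum_mul,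
        Finset.sum_product]
      refine Finset.sum_congr rfl fun p _ => ?_
      rw [Finset.sum_mul]
      refine Finset.sum_congr rfl fun p' _ => ?_
      simp only [hc]
      have e : ((p : ℝ) - p') * (x 0 + (n : ℝ) * α 0) = ((p : ℝ) - p') * x 0 + (n : ℝ) * (((p : ℝ) - p') * α 0) := by
        ring
      rw [e, AddChar.map_add_eq_mul, Circle.coe_mul]
      have e2 : (n : ℝ) * (β + ((p : ℝ) - p') * α 0) = (n : ℝ) * (((p : ℝ) - p') * α 0) + (n : ℝ) * β := by
        ring
      rw [e2, AddChar.map_add_eq_mul, Circle.coe_mul]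
      ring
    -- the main term
    have hmain : ‖∑ n ∈ Icc 1 N, ((μ n : ℝ) : ℂ) * (g n * (𝐞 ((n : ℝ) * β) : ℂ))‖ ≤
        ((H : ℝ) + 1) * (max C' 0 * M * N / L ^ (3 * A)) := by
      simp_rw [hexp, Finset.mul_sum]
      rw [Finset.sum_comm]
      calc ‖∑ q ∈ Ioc 0 (H + 1) ×ˢ Ioc 0 (H + 1), ∑ n ∈ Icc 1 N, ((μ n : ℝ) : ℂ) *
            ((𝐞 (((q.1 : ℝ) - q.2) * x 0) : ℂ) * ((H : ℂ) + 1)⁻¹ *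
              (c q.1 q.2 (Fin.tail x + (n : ℝ) • Fin.tail α) *
                (𝐞 ((n : ℝ) * (β + ((q.1 : ℝ) - q.2) * α 0)) : ℂ)))‖
          ≤ ∑ q ∈ Ioc 0 (H + 1) ×ˢ Ioc 0 (H + 1), ‖∑ n ∈ Icc 1 N, ((μ n : ℝ) : ℂ) *
            ((𝐞 (((q.1 : ℝ) - q.2) * x 0) : ℂ) * ((H : ℂ) + 1)⁻¹ *
              (c q.1 q.2 (Fin.tail x + (n : ℝ) • Fin.tail α) *
                (𝐞 ((n : ℝ) * (β + ((q.1 : ℝ) - q.2) * α 0)) : ℂ)))‖ := norm_sum_le _ _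
        _ ≤ ∑ _q ∈ Ioc 0 (H + 1) ×ˢ Ioc 0 (H + 1), ((H : ℝ) + 1)⁻¹ * (max C' 0 * M * N / L ^ (3 * A)) :=
            Finset.sum_le_sum fun q _ => by
              have hfac : ∑ n ∈ Icc 1 N, ((μ n : ℝ) : ℂ) *
                  ((𝐞 (((q.1 : ℝ) - q.2) * x 0) : ℂ) * ((H : ℂ) + 1)⁻¹ *
                    (c q.1 q.2 (Fin.tail x + (n : ℝ) • Fin.tail α) *
                      (𝐞 ((n : ℝ) * (β + ((q.1 : ℝ) - q.2) * α 0)) : ℂ))) =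
                  ((𝐞 (((q.1 : ℝ) - q.2) * x 0) : ℂ) * ((H : ℂ) + 1)⁻¹) *
                    ∑ n ∈ Icc 1 N, ((μ n : ℝ) : ℂ) * (c q.1 q.2 (Fin.tail x + (n : ℝ) • Fin.tail α) *
                      (𝐞 ((n : ℝ) * (β + ((q.1 : ℝ) - q.2) * α 0)) : ℂ)) := by
                rw [Finset.mul_sum]; exact Finset.sum_congr rfl fun n _ => by ring
              rw [hfac, norm_mul, norm_mul, norm_fourierChar, one_mul, norm_inv]
              have e : ‖((H : ℂ) + 1)‖ = (H : ℝ) + 1 := by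
                rw [show ((H : ℂ) + 1) = (((H : ℝ) + 1 : ℝ) : ℂ) by push_cast; ring, Complex.norm_real,
                  Real.norm_eq_abs, abs_of_pos hHpos]
              rw [e]
              exact mul_le_mul_of_nonneg_left (hC'0 M hM (c q.1 q.2) (hcper q.1 q.2) (hc1 q.1 q.2)
                (hclip q.1 q.2) N hN (Fin.tail α) (Fin.tail x) _) (by positivity)
        _ = ((H : ℝ) + 1) * (max C' 0 * M * N / L ^ (3 * A)) := by
            rw [Finset.sum_const, Finset.card_product, Nat.card_Ioc, nsmul_eq_mul]
            push_cast
            field_simp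
    have hmain' : ((H : ℝ) + 1) * (max C' 0 * M * N / L ^ (3 * A)) ≤ 3 * max C' 0 * M * N / L ^ A := by
      rw [hL3A, mul_div_assoc', div_le_div_iff₀ (by positivity) (by positivity)]
      have h1 : (H : ℝ) + 1 ≤ 3 * (L ^ A * L ^ A) := by rw [hL2A] at hHhi; nlinarith
      have h0 : 0 ≤ max C' 0 * M * N * L ^ A := by positivity
      calc ((H : ℝ) + 1) * (max C' 0 * M * N) * L ^ A = ((H : ℝ) + 1) * (max C' 0 * M * N * L ^ A) := by
            ring
        _ ≤ 3 * (L ^ A * L ^ A) * (max C' 0 * M * N * L ^ A) := mul_le_mul_of_nonneg_right h1 h0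
        _ = 3 * max C' 0 * M * N * (L ^ A * L ^ A * L ^ A) := by ring
    -- the error term
    have herrsum : ‖∑ n ∈ Icc 1 N, ((μ n : ℝ) : ℂ) *
        ((F (x + (n : ℝ) • α) - g n) * (𝐞 ((n : ℝ) * β) : ℂ))‖ ≤ N * (3 * M / L ^ A) := by
      calc _ ≤ ∑ n ∈ Icc 1 N, ‖((μ n : ℝ) : ℂ) * ((F (x + (n : ℝ) • α) - g n) * (𝐞 ((n : ℝ) * β) : ℂ))‖ :=
            norm_sum_le _ _
        _ ≤ ∑ _n ∈ Icc 1 N, (3 * M / L ^ A) := Finset.sum_le_sum fun n _ => by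
            rw [norm_mul, norm_mul, norm_fourierChar, mul_one, Complex.norm_real, Real.norm_eq_abs,
              norm_sub_rev]
            calc |(μ n : ℝ)| * ‖g n - F (x + (n : ℝ) • α)‖ ≤ 1 * (3 * M / L ^ A) := by
                  refine mul_le_mul ?_ (herr n) (norm_nonneg _) zero_le_one
                  exact_mod_cast ArithmeticFunction.abs_moebius_le_one
              _ = 3 * M / L ^ A := one_mul _
        _ = N * (3 * M / L ^ A) := by simp
    -- combine
    have hsplit : ∑ n ∈ Icc 1 N, ((μ n : ℝ) : ℂ) * (F (x + (n : ℝ) • α) * (𝐞 ((n : ℝ) * β) : ℂ)) =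
        ∑ n ∈ Icc 1 N, ((μ n : ℝ) : ℂ) * (g n * (𝐞 ((n : ℝ) * β) : ℂ)) +
          ∑ n ∈ Icc 1 N, ((μ n : ℝ) : ℂ) * ((F (x + (n : ℝ) • α) - g n) * (𝐞 ((n : ℝ) * β) : ℂ)) := by
      rw [← Finset.sum_add_distrib]
      exact Finset.sum_congr rfl fun n _ => by ring
    rw [hsplit]
    calc ‖∑ n ∈ Icc 1 N, ((μ n : ℝ) : ℂ) * (g n * (𝐞 ((n : ℝ) * β) : ℂ)) +
          ∑ n ∈ Icc 1 N, ((μ n : ℝ) : ℂ) * ((F (x + (n : ℝ) • α) - g n) * (𝐞 ((n : ℝ) * β) : ℂ))‖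
        ≤ ‖∑ n ∈ Icc 1 N, ((μ n : ℝ) : ℂ) * (g n * (𝐞 ((n : ℝ) * β) : ℂ))‖ +
          ‖∑ n ∈ Icc 1 N, ((μ n : ℝ) : ℂ) * ((F (x + (n : ℝ) • α) - g n) * (𝐞 ((n : ℝ) * β) : ℂ))‖ :=
            norm_add_le _ _
      _ ≤ 3 * max C' 0 * M * N / L ^ A + N * (3 * M / L ^ A) := add_le_add (hmain.trans hmain') herrsum
      _ ≤ (3 * max C' 0 + 4) * M * N / L ^ A := by
          have e : 3 * max C' 0 * M * N / L ^ A + N * (3 * M / L ^ A) =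
              (3 * max C' 0 + 3) * M * N / L ^ A := by ring
          rw [e, hL, div_le_div_iff_of_pos_right hLA]
          have : 0 ≤ M * N := mul_nonneg hM0 hNpos.le
          nlinarith

end Summit.Parity.GeneralizedHardyLittlewood.GreenTaoLevelTwoMNTwoMoebiusLipschitzTorus
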